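import Summits.ABC.IUTFork.Cor312BridgeHypsDHVol
import Summits.ABC.IUTFork.Cor312SettingDHVolRoute
import HarnessLib

/-!
# [IUTchIII] Corollary 3.12, statement — `BridgeHyps` for the real setting with the verbatim volumes when the
# Θ-boxes are HULL-SETS `λ_Θ·𝒪_L`; the NON-VACUITY witness (unit boxes)

Record-only file (D-0012) of the abc-iut cell (Cor. 3.12 sub-crew, seat abc-iut-c312-5, gen 3; D-0067 TEAM A row
A-0 «finiteness + BridgeHyps at the real setting»); TAKES NO SIDE. [IUTchIII] Rmk. 3.9.5 (vii) (kurims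
`paper:url-4b091feeb646` p. 131, (Ob1)): the arithmetic line bundle that gives rise to a pilot object "arises,
locally, as an ideal, i.e., an `𝒪_k`-submodule, contained in the `𝒪_k`-module `𝒪_k`" — in the tensor packets such
regions are HULL-SETS `λ·𝒪_L` ("subsets of the form `λ·𝒪`", Rmk. 3.9.5 (i) p. 127); Dupuy–Hilado §3.4:
`O_𝕃(−P_Θ)`, `O_𝕃(−P_q)`. The companion `Cor312BridgeHypsDHVol` derives c312-6's `BridgeHyps`
for c312-5's `Real.settingDHVol` from five conditions on the Θ-box binder; THIS file specialises them to the
shape the box providers deliver (abc-iut-c312-3 gen 4, `Cor312PilotIdelesHull`: "the factor image of the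
(Ind3)-region is the hull-set `λ_Θ·𝒪_L` at every prime"):

* `PadicPresentation.hullSet_eq_image_factorCoords`: a hull-set `λ·𝒪_L` of the field-factor coordinates IS the
  image of the direct product over the summands `v⃗` of the `ψ_{v⃗}⁻¹(λ_{v⃗}·𝒪)` — so hull-set boxes are
  product-shaped and admissible (`Real.hprod_of_isHullSet`, via the tree's `packetAdm_preimage_hullSet`), bounded
  and nondegenerate;
* **`Real.bridgeHyps_settingDHVol_of_hullSets`**: `BridgeHyps (Real.settingDHVol …)` from THREE conditions: some box
  at `∞` is nonempty; at every `(j ∈ 𝔽_l^⋇, p)` the union over `m` of the boxes is a hull-set; it is `𝒪_L` off a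
  finite prime set;
* `Real.bridgeHyps_settingDHVol_of_hullSets'` (the `∞`-nonemptiness derived from per-`m` hull-set boxes) and
  **`Real.statement_settingDHVol_of_globalVolumeTransport_of_hullSets`**: abc-iut-c312-6 (gen 4)'s landed route
  `statement_settingDHVol_of_globalVolumeTransport` (`Cor312SettingDHVolRoute`: Statement ⟸ `GlobalVolumeTransport`
  `+` hull-set boxes `+` `ThetaFinite`) with `ThetaFinite` DISCHARGED by `thetaFinite_settingDHVol`
  (`Cor312ThetaFiniteDHVol`): at `Real.settingDHVol` the printed Statement follows from the TEAM B gap input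
  G-c312-11-1 (NOT asserted) `+` hull-set-shaped Θ-boxes `+` "`= 𝒪_L` off a finite prime set" — no
  Kummer-realisation data and no finiteness residual left;
* **`Real.bridgeHyps_settingDHVol_unitBoxes`** — NON-VACUITY WITNESS of the whole `BridgeHyps` interface at the
  genuine real setting (vacuity audit, LANA Rem. 8.2.1 discipline): with the unit boxes `𝒪_L` everywhere (the
  trivial line bundle) `BridgeHyps` HOLDS, for any values of the context binders. This is a witness for the
  INTERFACE, not a statement about the Θ-pilot object of [IUTchIII] Def. 3.8 (i).
[claim: Mochizuki2012, status: disputed] for the quoted sentences; [cite: DupuyHilado2025, §3.4]. Deliberately NOT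
here: the Dupuy–Hilado Θ-boxes themselves (c312-3 `Cor312ThetaBoxesDH`/`Cor312PilotIdelesDH`), any judgement.
-/

noncomputable section

open Set Function NumberField IsDedekindDomain Bornology
open scoped Pointwise

namespace Summit.ABC

namespace IUTFork

namespace Cor312Vol

namespace PadicPresentation

open Thm311 Literature.IUT.LogThetaLattice Literature.IUT.LogVolume

variable {T : ThetaIndex} {L : LogShells T} {vQ : T.VQ} {p : ℕ} [hp : Fact p.Prime] (P : PadicPresentation L vQ p)

/-- **A hull-set of the field-factor coordinates is the image of a direct product over the summands**:
`λ·𝒪_L = factorCoords(Π_{v⃗} ψ_{v⃗}⁻¹(λ_{v⃗}·𝒪))` ([IUTchIII] Rmk. 3.9.5 (i) "`λ·𝒪`" read summand by summand;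
Dupuy–Hilado §4.12 "`hull(Ω) := Π_p hull(Ω_p)`"). [cite: DupuyHilado2025, §4.12] -/
theorem hullSet_eq_image_factorCoords (j : T.Label)
    (c : ∀ s : (Σ e : T.Caps j → T.Fibre vQ, DIdx p (P.kk e)), DFac p (P.kk s.1) s.2) :
    hullSet (fun s : (Σ e : T.Caps j → T.Fibre vQ, DIdx p (P.kk e)) => DFac p (P.kk s.1) s.2) c =
      P.factorCoords j '' Set.pi univ fun e =>
        dEquiv p (P.kk e) ⁻¹' hullSet (DFac p (P.kk e)) fun i => c ⟨e, i⟩ := by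
  ext z
  constructor
  · intro hz
    obtain ⟨y, rfl⟩ := P.factorCoords_surjective j z
    refine ⟨y, fun e _ => ?_, rfl⟩
    rw [Set.mem_preimage, hullSet, mem_polydisc]
    intro i
    exact (mem_polydisc _).1 hz ⟨e, i⟩
  · rintro ⟨y, hy, rfl⟩
    rw [hullSet, mem_polydisc]
    intro s
    obtain ⟨e, i⟩ := s
    have h := hy e (Set.mem_univ _)
    rw [Set.mem_preimage, hullSet, mem_polydisc] at h
    exact h i

end PadicPresentation

end Cor312Vol

namespace Thm311

namespace Real

open Cor312 Cor312Vol Literature.IUT.LogThetaLattice Literature.IUT.LogVolume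

variable {F : Type} [Field F] [NumberField F] (X : PilotData F) {logv : PadicLogs F} (hlog : LogvAnalytic logv)

section Setting

variable (M : Type) [Field M] [NumberField M]
  (archPk : ∀ (j : (thetaIndex X).Label) (vQ : (thetaIndex X).VQ), Set ((logShellsDH X logv).Packet j vQ))
  (archSub : ∀ (j : (thetaIndex X).Label) (v : (thetaIndex X).V),
    Set ((logShellsDH X logv).Packet j ((thetaIndex X).over v)))
  (Ψ : ℤ → ∀ v : (thetaIndex X).V, v ∈ (thetaIndex X).Vbad → Set ((logShellsDH X logv).StarPacket v))
  (act : ℤ → ∀ v : (thetaIndex X).V, v ∈ (thetaIndex X).Vbad →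
    (logShellsDH X logv).StarPacket v → Module.End ℚ ((logShellsDH X logv).StarPacket v))
  (Mmod : ℤ → ∀ j : (thetaIndex X).LabelStar, Set ((logShellsDH X logv).GlobalPacket j.1))
  (region : ℤ → ∀ j : (thetaIndex X).LabelStar, FinDivisor M → ∀ vQ : (thetaIndex X).VQ,
    Set ((logShellsDH X logv).Packet j.1 vQ))
  (n : ℤ) {HT : Type} {LogLink : HT → HT → Type} {IsFull : ∀ {s t : HT}, LogLink s t → Prop}
  (lat : LGPGaussianLogThetaLattice LogLink IsFull)
  {Frd : Type} {IsoF : Frd → Frd → Type} {Ob : Frd → Type} {realify : Frd → Frd} {Strip : Type}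
  {IsoS : Strip → Strip → Type} {Mv : ∀ v : (thetaIndex X).V, v ∈ (thetaIndex X).Vbad → Type}
  [∀ v h, Monoid (Mv v h)]
  (sig : GlobalLGPFrobenioidSignature (thetaIndex X).lstar (thetaIndex X).V (· ∈ (thetaIndex X).Vbad)
    Frd IsoF Ob realify Strip IsoS Mv)
  (split : SplittingMonoids Mv) {ObΔ : Type} {N : ∀ v : (thetaIndex X).V, v ∈ (thetaIndex X).Vbad → Type}
  [∀ v h, Monoid (N v h)] (qData : QPilotData ObΔ N)
  (thetaBox : ℤ → Ob sig.Clgp → ∀ (j : (thetaIndex X).Label) (vQ : (thetaIndex X).VQ),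
    Set (∀ s : factorIdxDH X hlog j vQ, factorFieldDH X hlog j vQ s))
  (qCentre : ObΔ → ∀ (j : (thetaIndex X).Label) (vQ : (thetaIndex X).VQ),
    ∀ s : factorIdxDH X hlog j vQ, factorFieldDH X hlog j vQ s)
  (hq : ∀ j vQ s, qCentre (qPilotObject qData) j vQ s ≠ 0)
  (hfin : ∀ j : (thetaIndex X).Label, (Function.support fun vQ =>
    ((situationDHVol X hlog M archPk archSub Ψ act Mmod region).D n).logvol j vQ
      (factorMapDH X hlog j vQ ⁻¹' hullSet (factorFieldDH X hlog j vQ) (qCentre (qPilotObject qData) j vQ))).Finite)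

/-! ## 1. Hull-set boxes are product-shaped, admissible, bounded and nondegenerate -/

/-- **A hull-set `λ·𝒪_L` at a prime is a direct product over the summands of positive-finite-measure sets**
(the `ψ_{v⃗}⁻¹(λ_{v⃗})·(R_{v⃗})^∼`, tree `packetAdm_preimage_hullSet`) — the condition `hprod` of
`bridgeHyps_settingDHVol_of_boxes` for hull-set boxes. [cite: DupuyHilado2025, §3.4] -/
theorem hprod_of_isHullSet (j : (thetaIndex X).Label) (pp : Nat.Primes)
    {U : Set (∀ s : factorIdxDH X hlog j (.inr pp), factorFieldDH X hlog j (.inr pp) s)}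
    (hU : Literature.IUT.LogVolume.IsHullSet (factorFieldDH X hlog j (.inr pp)) U) :
    haveI : Fact (pp : ℕ).Prime := ⟨pp.2⟩
    ∃ R : ∀ e : (thetaIndex X).Caps j → (thetaIndex X).Fibre (.inr pp), Set ((presAt X hlog pp).X e),
      (∀ e, PacketAdm (pp : ℕ) ((presAt X hlog pp).kk e) (R e)) ∧
      U = (presAt X hlog pp).factorCoords j '' Set.pi univ R := by
  haveI : Fact (pp : ℕ).Prime := ⟨pp.2⟩
  obtain ⟨c, hc, rfl⟩ := hU
  exact ⟨_, fun e => (presAt X hlog pp).packetAdm_preimage_hullSet e _ fun i => hc ⟨e, i⟩,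
    (presAt X hlog pp).hullSet_eq_image_factorCoords j c⟩

/-- **`BridgeHyps` for the real setting with the verbatim volumes when the Θ-boxes are hull-sets**: if some Θ-box
at `∞` is nonempty, the union over `m` of the Θ-boxes at every `(j ∈ 𝔽_l^⋇, p)` is a hull-set `λ_Θ·𝒪_L`
([IUTchIII] Rmk. 3.9.5 (vii) (Ob1): pilot regions arise locally as ideals; the shape delivered by abc-iut-c312-3's
`Cor312PilotIdelesHull` for the Dupuy–Hilado boxes), and it is `𝒪_L` off a finite prime set, then every field of
c312-6's `BridgeHyps (Real.settingDHVol …)` holds. [claim: Mochizuki2012, status: disputed] -/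
theorem bridgeHyps_settingDHVol_of_hullSets
    (hne : ∀ (i : Fin (thetaIndex X).lstar) (u : Unit),
      (⋃ m : ℤ, thetaBox m (thetaPilotObject sig split) (Setting.labelSucc i) (.inl u)).Nonempty)
    (hhul : ∀ (i : Fin (thetaIndex X).lstar) (pp : Nat.Primes),
      Literature.IUT.LogVolume.IsHullSet (factorFieldDH X hlog (Setting.labelSucc i) (.inr pp))
        (⋃ m : ℤ, thetaBox m (thetaPilotObject sig split) (Setting.labelSucc i) (.inr pp)))
    (hcof : ∀ i : Fin (thetaIndex X).lstar, {pp : Nat.Primes |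
      (⋃ m : ℤ, thetaBox m (thetaPilotObject sig split) (Setting.labelSucc i) (.inr pp)) ≠
        hullSet (factorFieldDH X hlog (Setting.labelSucc i) (.inr pp)) (fun _ => 1)}.Finite) :
    BridgeHyps
        (settingDHVol X hlog M archPk archSub Ψ act Mmod region n lat sig split qData thetaBox qCentre
          hq hfin) :=
  bridgeHyps_settingDHVol_of_boxes
      X hlog M archPk archSub Ψ act Mmod region n lat sig split qData thetaBox qCentre hq hfin hne
    (fun i pp => hprod_of_isHullSet X hlog (Setting.labelSucc i) pp (hhul i pp))
    (fun i pp => (hhul i pp).isBounded) (fun i pp => (hhul i pp).isNondegenerate) hcof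

/-! ## 2. B's route at the real setting: `Statement ⟸ GlobalVolumeTransport` for hull-set boxes -/

/-- Hull-set boxes at `∞` are nonempty (a hull-set over the empty factor index is everything). [folklore] -/
theorem hne_of_hullSets
    (hboxm : ∀ (m : ℤ) (i : Fin (thetaIndex X).lstar) (vQ : (thetaIndex X).VQ),
      Literature.IUT.LogVolume.IsHullSet (factorFieldDH X hlog (Setting.labelSucc i) vQ)
        (thetaBox m (thetaPilotObject sig split) (Setting.labelSucc i) vQ))
    (i : Fin (thetaIndex X).lstar) (u : Unit) :
    (⋃ m : ℤ, thetaBox m (thetaPilotObject sig split) (Setting.labelSucc i) (.inl u)).Nonempty := by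
  obtain ⟨c, -, hc⟩ := hboxm 0 i (.inl u)
  refine ⟨c, Set.mem_iUnion.2 ⟨0, ?_⟩⟩
  rw [hc]
  exact (mem_polydisc _).2 fun s => le_rfl

/-- `BridgeHyps` for hull-set boxes, the `∞`-clause derived from per-`m` hull-set boxes (every single Kummer image a
line bundle `λ·𝒪_L`). [claim: Mochizuki2012, status: disputed] -/
theorem bridgeHyps_settingDHVol_of_hullSets'
    (hboxm : ∀ (m : ℤ) (i : Fin (thetaIndex X).lstar) (vQ : (thetaIndex X).VQ),
      Literature.IUT.LogVolume.IsHullSet (factorFieldDH X hlog (Setting.labelSucc i) vQ)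
        (thetaBox m (thetaPilotObject sig split) (Setting.labelSucc i) vQ))
    (hhul : ∀ (i : Fin (thetaIndex X).lstar) (pp : Nat.Primes),
      Literature.IUT.LogVolume.IsHullSet (factorFieldDH X hlog (Setting.labelSucc i) (.inr pp))
        (⋃ m : ℤ, thetaBox m (thetaPilotObject sig split) (Setting.labelSucc i) (.inr pp)))
    (hcof : ∀ i : Fin (thetaIndex X).lstar, {pp : Nat.Primes |
      (⋃ m : ℤ, thetaBox m (thetaPilotObject sig split) (Setting.labelSucc i) (.inr pp)) ≠
        hullSet (factorFieldDH X hlog (Setting.labelSucc i) (.inr pp)) (fun _ => 1)}.Finite) :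
    BridgeHyps (settingDHVol X hlog M archPk archSub Ψ act Mmod region n lat sig split qData thetaBox qCentre
      hq hfin) :=
  bridgeHyps_settingDHVol_of_hullSets
      X hlog M archPk archSub Ψ act Mmod region n lat sig split qData thetaBox qCentre hq hfin
    (hne_of_hullSets X hlog sig split thetaBox hboxm) hhul hcof

/-- **The printed `Statement` of [IUTchIII] Cor. 3.12 at `Real.settingDHVol` ⟸ TEAM B's gap input + box SHAPE**:
abc-iut-c312-6 (gen 4)'s route `statement_settingDHVol_of_globalVolumeTransport` (monotonicity of the verbatim
log-volume + `ThetaRegionsAdm` from hull-set boxes + `ThetaFinite`) with `ThetaFinite` DISCHARGED by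
`thetaFinite_settingDHVol`: from abc-iut-c312-11's `GlobalVolumeTransport` (G-c312-11-1, kurims p. 184 l. 30–34 —
NOT asserted; whether it follows from the frozen FACT LIST is TEAM B's adjudication), every Θ-box a hull-set, the
unions over `m` hull-sets at every `(j ∈ 𝔽_l^⋇, p)`, and `= 𝒪_L` off a finite prime set.
[claim: Mochizuki2012, status: disputed] -/
theorem statement_settingDHVol_of_globalVolumeTransport_of_hullSets
    (hboxm : ∀ (m : ℤ) (i : Fin (thetaIndex X).lstar) (vQ : (thetaIndex X).VQ),
      Literature.IUT.LogVolume.IsHullSet (factorFieldDH X hlog (Setting.labelSucc i) vQ)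
        (thetaBox m (thetaPilotObject sig split) (Setting.labelSucc i) vQ))
    (hhul : ∀ (i : Fin (thetaIndex X).lstar) (pp : Nat.Primes),
      Literature.IUT.LogVolume.IsHullSet (factorFieldDH X hlog (Setting.labelSucc i) (.inr pp))
        (⋃ m : ℤ, thetaBox m (thetaPilotObject sig split) (Setting.labelSucc i) (.inr pp)))
    (hcof : ∀ i : Fin (thetaIndex X).lstar, {pp : Nat.Primes |
      (⋃ m : ℤ, thetaBox m (thetaPilotObject sig split) (Setting.labelSucc i) (.inr pp)) ≠
        hullSet (factorFieldDH X hlog (Setting.labelSucc i) (.inr pp)) (fun _ => 1)}.Finite)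
    (hgvt : GlobalVolumeTransport (settingDHVol X hlog M archPk archSub Ψ act Mmod region n lat sig split qData
      thetaBox qCentre hq hfin)) :
    (settingDHVol X hlog M archPk archSub Ψ act Mmod region n lat sig split qData thetaBox qCentre hq
      hfin).Statement :=
  statement_settingDHVol_of_globalVolumeTransport
      X hlog M archPk archSub Ψ act Mmod region n lat sig split qData thetaBox qCentre hq hfin hboxm
    (thetaFinite_settingDHVol X hlog M archPk archSub Ψ act Mmod region n lat sig split qData thetaBox qCentre hq hfin
      (fun i pp => (hhul i pp).isBounded) (fun i pp => (hhul i pp).isNondegenerate) hcof)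
    hgvt

end Setting

/-! ## 3. Non-vacuity: the unit boxes -/

section Witness

variable (M : Type) [Field M] [NumberField M]
  (archPk : ∀ (j : (thetaIndex X).Label) (vQ : (thetaIndex X).VQ), Set ((logShellsDH X logv).Packet j vQ))
  (archSub : ∀ (j : (thetaIndex X).Label) (v : (thetaIndex X).V),
    Set ((logShellsDH X logv).Packet j ((thetaIndex X).over v)))
  (Ψ : ℤ → ∀ v : (thetaIndex X).V, v ∈ (thetaIndex X).Vbad → Set ((logShellsDH X logv).StarPacket v))
  (act : ℤ → ∀ v : (thetaIndex X).V, v ∈ (thetaIndex X).Vbad →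
    (logShellsDH X logv).StarPacket v → Module.End ℚ ((logShellsDH X logv).StarPacket v))
  (Mmod : ℤ → ∀ j : (thetaIndex X).LabelStar, Set ((logShellsDH X logv).GlobalPacket j.1))
  (region : ℤ → ∀ j : (thetaIndex X).LabelStar, FinDivisor M → ∀ vQ : (thetaIndex X).VQ,
    Set ((logShellsDH X logv).Packet j.1 vQ))
  (n : ℤ) {HT : Type} {LogLink : HT → HT → Type} {IsFull : ∀ {s t : HT}, LogLink s t → Prop}
  (lat : LGPGaussianLogThetaLattice LogLink IsFull)
  {Frd : Type} {IsoF : Frd → Frd → Type} {Ob : Frd → Type} {realify : Frd → Frd} {Strip : Type}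
  {IsoS : Strip → Strip → Type} {Mv : ∀ v : (thetaIndex X).V, v ∈ (thetaIndex X).Vbad → Type}
  [∀ v h, Monoid (Mv v h)]
  (sig : GlobalLGPFrobenioidSignature (thetaIndex X).lstar (thetaIndex X).V (· ∈ (thetaIndex X).Vbad)
    Frd IsoF Ob realify Strip IsoS Mv)
  (split : SplittingMonoids Mv) {ObΔ : Type} {N : ∀ v : (thetaIndex X).V, v ∈ (thetaIndex X).Vbad → Type}
  [∀ v h, Monoid (N v h)] (qData : QPilotData ObΔ N)
  (qCentre : ObΔ → ∀ (j : (thetaIndex X).Label) (vQ : (thetaIndex X).VQ),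
    ∀ s : factorIdxDH X hlog j vQ, factorFieldDH X hlog j vQ s)
  (hq : ∀ j vQ s, qCentre (qPilotObject qData) j vQ s ≠ 0)
  (hfin : ∀ j : (thetaIndex X).Label, (Function.support fun vQ =>
    ((situationDHVol X hlog M archPk archSub Ψ act Mmod region).D n).logvol j vQ
      (factorMapDH X hlog j vQ ⁻¹' hullSet (factorFieldDH X hlog j vQ) (qCentre (qPilotObject qData) j vQ))).Finite)

/-- **NON-VACUITY WITNESS: with the unit boxes `𝒪_L` everywhere, `BridgeHyps (Real.settingDHVol …)` HOLDS**, for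
any values of the context binders (lattice, Prop. 3.7 output, q-pilot data, q-centre): every box is a hull-set,
nonempty at `∞`, and equal to `𝒪_L` at every prime. A witness for the INTERFACE of `Cor312BridgeHypsDHVol`; not a
statement about the Θ-pilot object of [IUTchIII] Def. 3.8 (i). [folklore] -/
theorem bridgeHyps_settingDHVol_unitBoxes :
    BridgeHyps (settingDHVol X hlog M archPk archSub Ψ act Mmod region n lat sig split qData
      (fun (_ : ℤ) (_ : Ob sig.Clgp) (j : (thetaIndex X).Label) (vQ : (thetaIndex X).VQ) =>
        hullSet (factorFieldDH X hlog j vQ) (fun _ => 1)) qCentre hq hfin) := by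
  refine bridgeHyps_settingDHVol_of_hullSets X hlog M archPk archSub Ψ act Mmod region n lat sig split qData _
    qCentre hq hfin (fun i u => ?_) (fun i pp => ?_) (fun i => ?_)
  · simp only [Set.iUnion_const]
    exact ⟨fun s => s.elim, (mem_polydisc _).2 fun s => s.elim⟩
  · simp only [Set.iUnion_const]
    exact ⟨fun _ => 1, fun _ => one_ne_zero, rfl⟩
  · refine Set.finite_empty.subset fun pp hpp => ?_
    exact hpp (by simp only [Set.iUnion_const])

end Witness

end Real

end Thm311

end IUTFork

end Summit.ABC

end
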